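import Literature.Geometry.Manifold.ProperSubmersionProduct
import Literature.Topology.FourManifolds.ClosedBallProofs
import Literature.Topology.FourManifolds.SimplifiedBrokenLefschetzFibrationProofs
import Literature.Topology.FourManifolds.Knots
import HarnessLib

/-!
# The sides of a Lefschetz-free simplified broken Lefschetz fibration are products `F × ℝ²`

Topic `Literature/Topology/FourManifolds`; a brick for the genus-one rung
`nonempty_diffeomorph_sphere_four_of_sblf_genus_one_noLefschetz` (Baykur–Kamada 2015, Lemma 11)
of `SimplifiedBrokenLefschetzFibration.lean`.  Everything here is **proved**; there are no
definitions and no named facts.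

Baykur–Kamada 2015, §2 (arXiv p. 7): an SBLF decomposes into *"three pieces; a genus `g - 1`
Lefschetz fibration over a `2`-disk we call the lower side, a genus `g` Lefschetz fibration over a
`2`-disk called the higher side, and a round cobordism between them containing the round singular
set in the interior"*, and without Lefschetz singularities a side *"consists of a trivial …
surface bundle"*.  After the normalisation of the round image to the equator
(`IsSimplifiedBrokenLefschetzFibration.exists_image_round_eq_sphereEquator`,
`SimplifiedBrokenLefschetzRoundImage.lean`) the two sides sit over the open hemispheres
`{y | y₂ > 0}` and `{y | y₂ < 0}` of `S²`, and this file proves the OPEN form of the quoted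
decomposition: the preimage of an open hemisphere consisting of regular values is the product of
the fibre over its centre with `ℝ²`, fibrewise.

* `exists_isSmoothEmbedding_prod_range_eq_preimage_hemisphere` — **general form** (Ehresmann's
  theorem over an open hemisphere, Bröcker–Jänich (8.12) in the tree's form
  `Literature.Geometry.Manifold.exists_isSmoothEmbedding_prod_euclidean_range_eq_of_surjective_mfderiv`):
  let `M` be a compact `C^∞` manifold (Hausdorff, second countable, boundaryless
  finite-dimensional model), `f : M → 𝕊ⁿ⁺¹` smooth, `v` a point of the sphere such that every
  point `q` with `⟪f q, v⟫ < 0` is regular, and `σ : F ↪ M` a smooth embedding onto the fibre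
  `f⁻¹(-v)`.  Then there is a smooth embedding `ι : F × ℝⁿ⁺¹ ↪ M` with
  `range ι = f⁻¹{y | ⟪y, v⟫ < 0}`, `ι (θ, 0) = σ θ` and
  `f (ι (θ, w)) = σᵥ⁻¹ (univBall 0 2 w)` (`σᵥ = stereographic' (n + 1) v`, Mathlib's chart of the
  sphere from `v`, under which the open hemisphere opposite `v` is the ball of radius `2`,
  `⟪σᵥ⁻¹ w, v⟫ = (‖w‖² - 4)/(‖w‖² + 4)`, `inner_stereographic'_symm` of `ClosedBallProofs.lean`).
  The map `κ = (univBall 0 2)⁻¹ ∘ σᵥ` is a diffeomorphism of the open hemisphere onto `ℝⁿ⁺¹`,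
  so `κ ∘ f` is a proper submersion of `f⁻¹(hemisphere)` onto `ℝⁿ⁺¹` with fibre `σ(F)` over `0`.
* `IsSimplifiedBrokenLefschetzFibration.exists_isSmoothEmbedding_prod_range_eq_preimage_hemisphere`
  — **the sides of a Lefschetz-free SBLF with equatorial round image**: for an SBLF
  `f : X → S²` on a closed 4-manifold with `L = ∅` whose round image is the equator
  `sphereEquator 1 = {y | y₂ = 0}`, and `v = ±e₂` a pole, there are a closed connected surface
  `F` and a smooth embedding `ι : F × ℝ² ↪ X` onto `f⁻¹{y | ⟪y, v⟫ < 0}` with `ι (·, 0)` a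
  smooth embedding onto the fibre `f⁻¹(-v)` and `f (ι (θ, w)) = σᵥ⁻¹ (univBall 0 2 w)`.

## References

* R. İ. Baykur, S. Kamada, *Classification of broken Lefschetz fibrations with small fiber
  genera*, J. Math. Soc. Japan 67 (2015), §2 (arXiv p. 7) and Lemma 11. [BaykurKamada2015]
* Th. Bröcker, K. Jänich, *Introduction to Differential Topology* (1982), (8.12).
  [BrockerJanichIDT1982]
-/

noncomputable section

open scoped Manifold ContDiff Topology InnerProductSpace EuclideanSpace
open Set Function Metric OpenPartialHomeomorph

namespace Literature.Topology.FourManifolds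

universe u

/-! ### The open hemisphere opposite a pole as the ball of radius `2` of the stereographic chart -/

section Hemisphere

variable {n : ℕ}

/-- A point of the open hemisphere opposite `v` is not the pole `v`. [folklore] -/
theorem ne_of_inner_lt_zero {v y : (Metric.sphere (0 : EuclideanSpace ℝ (Fin (n + 1 + 1))) 1)}
    (hy : ⟪(y : EuclideanSpace ℝ (Fin (n + 1 + 1))),
          (v : EuclideanSpace ℝ (Fin (n + 1 + 1)))⟫_ℝ < 0) : y ≠ v := by
  rintro rfl
  have : ⟪(y : EuclideanSpace ℝ (Fin (n + 1 + 1))),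
        (y : EuclideanSpace ℝ (Fin (n + 1 + 1)))⟫_ℝ = 1 := by simp [norm_eq_of_mem_sphere]
  linarith

/-- The open hemisphere opposite `v` lies in the source of the stereographic chart from `v`.
[folklore] -/
theorem mem_source_stereographic'_of_inner_lt_zero {v y : (Metric.sphere (0 : EuclideanSpace ℝ (Fin
      (n + 1 + 1))) 1)}
    (hy : ⟪(y : EuclideanSpace ℝ (Fin (n + 1 + 1))),
          (v : EuclideanSpace ℝ (Fin (n + 1 + 1)))⟫_ℝ < 0) :
    y ∈ (stereographic' (n + 1) v).source := by
  rw [stereographic'_source]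
  exact ne_of_inner_lt_zero hy

/-- The antipode `-v` lies in the open hemisphere opposite `v`. [folklore] -/
theorem inner_neg_self_lt_zero (v : (Metric.sphere (0 : EuclideanSpace ℝ (Fin (n + 1 + 1))) 1)) :
    ⟪((-v : (Metric.sphere (0 : EuclideanSpace ℝ (Fin (n + 1 + 1))) 1)) : EuclideanSpace ℝ (Fin (n
          + 1 + 1))), (v : EuclideanSpace ℝ (Fin (n + 1 + 1)))⟫_ℝ < 0 := by
  have : ⟪(v : EuclideanSpace ℝ (Fin (n + 1 + 1))),
        (v : EuclideanSpace ℝ (Fin (n + 1 + 1)))⟫_ℝ = 1 := by simp [norm_eq_of_mem_sphere]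
  rw [coe_neg_sphere, inner_neg_left, this]
  norm_num

/-- **Under the stereographic chart from `v`, the open hemisphere opposite `v` is the open ball of
radius `2`.** [folklore] -/
theorem norm_stereographic'_lt_two_iff_inner_lt_zero {v y : (Metric.sphere (0 : EuclideanSpace ℝ
      (Fin (n + 1 + 1))) 1)} (hy : y ≠ v) :
    ‖stereographic' (n + 1) v y‖ < 2 ↔ ⟪(y : EuclideanSpace ℝ (Fin (n + 1 + 1))),
          (v : EuclideanSpace ℝ (Fin (n + 1 + 1)))⟫_ℝ < 0 := by
  have hys : y ∈ (stereographic' (n + 1) v).source := by rwa [stereographic'_source]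
  obtain ⟨w, hw⟩ : ∃ w, stereographic' (n + 1) v y = w := ⟨_, rfl⟩
  have hyw : y = (stereographic' (n + 1) v).symm w := by
    rw [← hw]; exact ((stereographic' (n + 1) v).left_inv hys).symm
  rw [hw, hyw, inner_stereographic'_symm]
  have h4 : 0 < ‖w‖ ^ 2 + 4 := by positivity
  have h0 := norm_nonneg w
  constructor
  · intro h
    exact div_neg_of_neg_of_pos (by nlinarith) h4
  · intro h
    have h' : ‖w‖ ^ 2 - 4 < 0 := by
      by_contra h''
      exact absurd h (not_lt.2 (div_nonneg (not_lt.1 h'') h4.le))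
    nlinarith

/-- `σᵥ⁻¹ (univBall 0 2 w)` lies in the open hemisphere opposite `v`. [folklore] -/
theorem inner_stereographic'_symm_univBall_lt_zero (v : (Metric.sphere (0 : EuclideanSpace ℝ (Fin
      (n + 1 + 1))) 1)) (w : EuclideanSpace ℝ (Fin (n + 1))) :
    ⟪(((stereographic' (n + 1) v).symm (univBall (0 : EuclideanSpace ℝ (Fin (n + 1))) 2 w) :
          (Metric.sphere (0 : EuclideanSpace ℝ (Fin (n + 1 + 1))) 1)) :
        EuclideanSpace ℝ (Fin (n + 1 + 1))), (v : EuclideanSpace ℝ (Fin (n + 1 + 1)))⟫_ℝ < 0 := by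
  rw [inner_stereographic'_symm]
  have hw : ‖univBall (0 : EuclideanSpace ℝ (Fin (n + 1))) 2 w‖ < 2 := by
    have := (univBall (0 : EuclideanSpace ℝ (Fin (n + 1))) 2).map_source (x := w)
      (by rw [univBall_source]; exact mem_univ _)
    rwa [univBall_target _ two_pos, mem_ball_zero_iff] at this
  have h0 := norm_nonneg (univBall (0 : EuclideanSpace ℝ (Fin (n + 1))) 2 w)
  exact div_neg_of_neg_of_pos (by nlinarith) (by positivity)

/-- `κ ∘ ψ = id` for `κ = (univBall 0 2)⁻¹ ∘ σᵥ` and `ψ = σᵥ⁻¹ ∘ univBall 0 2`. [folklore] -/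
theorem univBall_symm_stereographic'_stereographic'_symm_univBall (v : (Metric.sphere (0 :
      EuclideanSpace ℝ (Fin (n + 1 + 1))) 1))
    (w : EuclideanSpace ℝ (Fin (n + 1))) :
    (univBall (0 : EuclideanSpace ℝ (Fin (n + 1))) 2).symm (stereographic' (n + 1) v
      ((stereographic' (n + 1) v).symm
        (univBall (0 : EuclideanSpace ℝ (Fin (n + 1))) 2 w))) = w := by
  rw [(stereographic' (n + 1) v).right_inv (by simp),
    (univBall (0 : EuclideanSpace ℝ (Fin (n + 1))) 2).left_inv (by simp)]

/-- `ψ ∘ κ = id` on the open hemisphere opposite `v`. [folklore] -/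
theorem stereographic'_symm_univBall_univBall_symm_stereographic' {v y : (Metric.sphere (0 :
      EuclideanSpace ℝ (Fin (n + 1 + 1))) 1)}
    (hy : ⟪(y : EuclideanSpace ℝ (Fin (n + 1 + 1))),
          (v : EuclideanSpace ℝ (Fin (n + 1 + 1)))⟫_ℝ < 0) :
    (stereographic' (n + 1) v).symm (univBall (0 : EuclideanSpace ℝ (Fin (n + 1))) 2
      ((univBall (0 : EuclideanSpace ℝ (Fin (n + 1))) 2).symm
        (stereographic' (n + 1) v y))) = y := by
  have hys := mem_source_stereographic'_of_inner_lt_zero hy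
  have hball : stereographic' (n + 1) v y ∈ (univBall (0 : EuclideanSpace ℝ (Fin (n + 1)))
        2).target := by
    rw [univBall_target _ two_pos, mem_ball_zero_iff]
    exact (norm_stereographic'_lt_two_iff_inner_lt_zero (ne_of_inner_lt_zero hy)).2 hy
  rw [(univBall (0 : EuclideanSpace ℝ (Fin (n + 1))) 2).right_inv hball,
        (stereographic' (n + 1) v).left_inv hys]

/-- `ψ = σᵥ⁻¹ ∘ univBall 0 2 : ℝⁿ⁺¹ → 𝕊ⁿ⁺¹` is smooth. [folklore] -/
theorem contMDiff_stereographic'_symm_univBall (v : (Metric.sphere (0 : EuclideanSpace ℝ (Fin (n +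
      1 + 1))) 1)) :
    ContMDiff 𝓘(ℝ, EuclideanSpace ℝ (Fin (n + 1))) (𝓡 (n + 1)) ∞
      (fun w : EuclideanSpace ℝ (Fin (n + 1)) ↦ (stereographic' (n + 1) v).symm (univBall (0 :
            EuclideanSpace ℝ (Fin (n + 1))) 2 w)) := by
  have hatlas : stereographic' (n + 1) v ∈
      IsManifold.maximalAtlas (𝓡 (n + 1)) ∞
        (Metric.sphere (0 : EuclideanSpace ℝ (Fin (n + 1 + 1))) 1) :=
    IsManifold.subset_maximalAtlas ⟨v, rfl⟩
  have h1 : ContMDiff (𝓡 (n + 1)) (𝓡 (n + 1)) ∞ (stereographic' (n + 1) v).symm := by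
    rw [← contMDiffOn_univ, ← stereographic'_target v]
    exact contMDiffOn_symm_of_mem_maximalAtlas hatlas
  exact h1.comp contDiff_univBall.contMDiff

/-- `κ = (univBall 0 2)⁻¹ ∘ σᵥ` is smooth on the open hemisphere opposite `v`. [folklore] -/
theorem contMDiffOn_univBall_symm_stereographic' (v : (Metric.sphere (0 : EuclideanSpace ℝ (Fin (n
      + 1 + 1))) 1)) :
    ContMDiffOn (𝓡 (n + 1)) 𝓘(ℝ, EuclideanSpace ℝ (Fin (n + 1))) ∞
      (fun y : (Metric.sphere (0 : EuclideanSpace ℝ (Fin (n + 1 + 1))) 1) ↦ (univBall (0 :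
            EuclideanSpace ℝ (Fin (n + 1))) 2).symm (stereographic' (n + 1) v y))
      {y | ⟪(y : EuclideanSpace ℝ (Fin (n + 1 + 1))),
            (v : EuclideanSpace ℝ (Fin (n + 1 + 1)))⟫_ℝ < 0} := by
  have hatlas : stereographic' (n + 1) v ∈
      IsManifold.maximalAtlas (𝓡 (n + 1)) ∞
        (Metric.sphere (0 : EuclideanSpace ℝ (Fin (n + 1 + 1))) 1) :=
    IsManifold.subset_maximalAtlas ⟨v, rfl⟩
  have h1 : ContMDiffOn (𝓡 (n + 1)) (𝓡 (n + 1)) ∞ (stereographic' (n + 1) v)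
      {y | ⟪(y : EuclideanSpace ℝ (Fin (n + 1 + 1))),
            (v : EuclideanSpace ℝ (Fin (n + 1 + 1)))⟫_ℝ < 0} :=
    (contMDiffOn_of_mem_maximalAtlas hatlas).mono
      fun y hy ↦ mem_source_stereographic'_of_inner_lt_zero hy
  have h2 : ContMDiffOn 𝓘(ℝ, EuclideanSpace ℝ (Fin (n + 1))) 𝓘(ℝ, EuclideanSpace ℝ (Fin (n + 1))) ∞
      (univBall (0 : EuclideanSpace ℝ (Fin (n + 1))) 2).symm (ball 0 2) :=
    contDiffOn_univBall_symm.contMDiffOn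
  refine h2.comp h1 fun y hy ↦ ?_
  rw [mem_preimage, mem_ball_zero_iff]
  exact (norm_stereographic'_lt_two_iff_inner_lt_zero (ne_of_inner_lt_zero hy)).2 hy

/-- The open hemisphere opposite `v` is open. [folklore] -/
theorem isOpen_setOf_inner_lt_zero (v : (Metric.sphere (0 : EuclideanSpace ℝ (Fin (n + 1 + 1))) 1))
      :
    IsOpen {y : (Metric.sphere (0 : EuclideanSpace ℝ (Fin (n + 1 + 1))) 1) | ⟪(y : EuclideanSpace ℝ
          (Fin (n + 1 + 1))), (v : EuclideanSpace ℝ (Fin (n + 1 + 1)))⟫_ℝ < 0} :=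
  isOpen_lt (continuous_subtype_val.inner continuous_const) continuous_const

/-- **`κ = (univBall 0 2)⁻¹ ∘ σᵥ` is a submersion on the open hemisphere opposite `v`**: its
differential is onto, because `κ ∘ ψ = id` with `ψ` smooth. [folklore] -/
theorem surjective_mfderiv_univBall_symm_stereographic' {v y : (Metric.sphere (0 : EuclideanSpace ℝ
      (Fin (n + 1 + 1))) 1)}
    (hy : ⟪(y : EuclideanSpace ℝ (Fin (n + 1 + 1))),
          (v : EuclideanSpace ℝ (Fin (n + 1 + 1)))⟫_ℝ < 0) :
    Surjective (mfderiv (𝓡 (n + 1)) 𝓘(ℝ, EuclideanSpace ℝ (Fin (n + 1)))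
      (fun y : (Metric.sphere (0 : EuclideanSpace ℝ (Fin (n + 1 + 1))) 1) ↦ (univBall (0 :
            EuclideanSpace ℝ (Fin (n + 1))) 2).symm (stereographic' (n + 1) v y)) y) := by
  set κ := fun y : (Metric.sphere (0 : EuclideanSpace ℝ (Fin (n + 1 + 1))) 1) ↦ (univBall (0 :
        EuclideanSpace ℝ (Fin (n + 1))) 2).symm (stereographic' (n + 1) v y)
    with hκ
  set ψ := fun w : EuclideanSpace ℝ (Fin (n + 1)) ↦ (stereographic' (n + 1) v).symm (univBall (0 :
        EuclideanSpace ℝ (Fin (n + 1))) 2 w)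
    with hψ
  have hκψ : κ ∘ ψ = id :=
    funext fun w ↦ univBall_symm_stereographic'_stereographic'_symm_univBall v w
  obtain ⟨w, hw⟩ : ∃ w, κ y = w := ⟨_, rfl⟩
  have hyw : ψ w = y := by
    rw [← hw]
    exact stereographic'_symm_univBall_univBall_symm_stereographic' hy
  have hκd : MDifferentiableAt (𝓡 (n + 1)) 𝓘(ℝ, EuclideanSpace ℝ (Fin (n + 1))) κ (ψ w) := by
    rw [hyw]
    exact ((contMDiffOn_univBall_symm_stereographic' v).contMDiffAt
      ((isOpen_setOf_inner_lt_zero v).mem_nhds hy)).mdifferentiableAt (by simp)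
  have hψd : MDifferentiableAt 𝓘(ℝ, EuclideanSpace ℝ (Fin (n + 1))) (𝓡 (n + 1)) ψ w :=
    ((contMDiff_stereographic'_symm_univBall v) w).mdifferentiableAt (by simp)
  have hchain := mfderiv_comp w hκd hψd
  rw [hκψ, mfderiv_id] at hchain
  have key : ∀ c, mfderiv (𝓡 (n + 1)) 𝓘(ℝ, EuclideanSpace ℝ (Fin (n + 1))) κ (ψ w)
      (mfderiv 𝓘(ℝ, EuclideanSpace ℝ (Fin (n + 1))) (𝓡 (n + 1)) ψ w c) = c := fun c ↦
    (DFunLike.congr_fun hchain c).symm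
  rw [hyw] at key
  exact fun c ↦ ⟨_, key c⟩

/-- On the open hemisphere, `κ⁻¹(s) = ψ(s)`. [folklore] -/
theorem setOf_inner_lt_zero_inter_preimage (v : (Metric.sphere (0 : EuclideanSpace ℝ (Fin (n + 1 +
      1))) 1)) (s : Set (EuclideanSpace ℝ (Fin (n + 1)))) :
    {y : (Metric.sphere (0 : EuclideanSpace ℝ (Fin (n + 1 + 1))) 1) | ⟪(y : EuclideanSpace ℝ (Fin
          (n + 1 + 1))), (v : EuclideanSpace ℝ (Fin (n + 1 + 1)))⟫_ℝ < 0} ∩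
      (fun y : (Metric.sphere (0 : EuclideanSpace ℝ (Fin (n + 1 + 1))) 1) ↦ (univBall (0 :
            EuclideanSpace ℝ (Fin (n + 1))) 2).symm (stereographic' (n + 1) v y)) ⁻¹' s =
    (fun w : EuclideanSpace ℝ (Fin (n + 1)) ↦ (stereographic' (n + 1) v).symm (univBall (0 :
          EuclideanSpace ℝ (Fin (n + 1))) 2 w)) '' s := by
  ext y
  constructor
  · rintro ⟨hy, hys⟩
    exact ⟨_, hys, stereographic'_symm_univBall_univBall_symm_stereographic' hy⟩
  · rintro ⟨w, hw, rfl⟩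
    refine ⟨inner_stereographic'_symm_univBall_lt_zero v w, ?_⟩
    rw [mem_preimage, univBall_symm_stereographic'_stereographic'_symm_univBall]
    exact hw

end Hemisphere

/-! ### The preimage of an open hemisphere of regular values is a product -/

section General

variable {n : ℕ} {E : Type*} [NormedAddCommGroup E] [NormedSpace ℝ E] [FiniteDimensional ℝ E]
  {H : Type*} [TopologicalSpace H] {I : ModelWithCorners ℝ E H} [I.Boundaryless]
  {M : Type*} [TopologicalSpace M] [ChartedSpace H M] [IsManifold I ∞ M] [T2Space M]
  [SecondCountableTopology M] [CompactSpace M]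
  {EF : Type*} [NormedAddCommGroup EF] [NormedSpace ℝ EF] {HF : Type*} [TopologicalSpace HF]
  {IF : ModelWithCorners ℝ EF HF} [IF.Boundaryless]
  {F : Type*} [TopologicalSpace F] [ChartedSpace HF F] [IsManifold IF ∞ F]

/-- **The preimage of an open hemisphere of regular values is the product of the central fibre
with `ℝⁿ⁺¹`.**  Let `M` be a compact `C^∞` manifold (Hausdorff, second countable, over a
boundaryless finite-dimensional model), `f : M → 𝕊ⁿ⁺¹` smooth, `v ∈ 𝕊ⁿ⁺¹` such that `df_q` is
onto whenever `⟪f q, v⟫ < 0`, and `σ : F ↪ M` a smooth embedding (boundaryless `F`,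
`L : E_F × ℝⁿ⁺¹ ≃ E`) with `σ(F) = f⁻¹(-v)`.  Then there is a smooth embedding
`ι : F × ℝⁿ⁺¹ ↪ M` with `range ι = f⁻¹{y | ⟪y, v⟫ < 0}`, `ι (θ, 0) = σ θ` and
`f (ι (θ, w)) = σᵥ⁻¹ (univBall 0 2 w)` (`σᵥ = stereographic' (n + 1) v`): Ehresmann's theorem
(`Literature.Geometry.Manifold.exists_isSmoothEmbedding_prod_euclidean_range_eq_of_surjective_mfderiv`)
for the proper submersion `κ ∘ f : f⁻¹(hemisphere) → ℝⁿ⁺¹`, `κ = (univBall 0 2)⁻¹ ∘ σᵥ` the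
diffeomorphism of the open hemisphere opposite `v` onto `ℝⁿ⁺¹`.
[cite: BrockerJanichIDT1982, (8.12) (PDF pp. 57–58)] [cite: BaykurKamada2015, §2 (arXiv p. 7)] -/
theorem exists_isSmoothEmbedding_prod_range_eq_preimage_hemisphere
    {f : M → (Metric.sphere (0 : EuclideanSpace ℝ (Fin (n + 1 + 1))) 1)} (hf : ContMDiff I (𝓡 (n +
          1)) ∞ f) (v : (Metric.sphere (0 : EuclideanSpace ℝ (Fin (n + 1 + 1))) 1))
    (hreg : ∀ q, ⟪(f q : EuclideanSpace ℝ (Fin (n + 1 + 1))),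
          (v : EuclideanSpace ℝ (Fin (n + 1 + 1)))⟫_ℝ < 0 →
      Surjective (mfderiv I (𝓡 (n + 1)) f q))
    {σ : F → M} (hσ : Manifold.IsSmoothEmbedding IF I ∞ σ) (L : (EF × EuclideanSpace ℝ (Fin (n +
          1))) ≃L[ℝ] E)
    (hσf : range σ = f ⁻¹' {-v}) :
    ∃ ι : F × EuclideanSpace ℝ (Fin (n + 1)) → M, Manifold.IsSmoothEmbedding (IF.prod 𝓘(ℝ,
          EuclideanSpace ℝ (Fin (n + 1)))) I ∞ ι ∧
      range ι = f ⁻¹' {y | ⟪(y : EuclideanSpace ℝ (Fin (n + 1 + 1))),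
            (v : EuclideanSpace ℝ (Fin (n + 1 + 1)))⟫_ℝ < 0} ∧
      (∀ θ, ι (θ, 0) = σ θ) ∧
      ∀ p, f (ι p) = (stereographic' (n + 1) v).symm (univBall (0 : EuclideanSpace ℝ (Fin (n + 1)))
            2 p.2) := by
  set hem : Set ((Metric.sphere (0 : EuclideanSpace ℝ (Fin (n + 1 + 1))) 1)) := {y | ⟪(y :
        EuclideanSpace ℝ (Fin (n + 1 + 1))), (v : EuclideanSpace ℝ (Fin (n + 1 + 1)))⟫_ℝ < 0}
    with hhem
  set κ := fun y : (Metric.sphere (0 : EuclideanSpace ℝ (Fin (n + 1 + 1))) 1) ↦ (univBall (0 :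
        EuclideanSpace ℝ (Fin (n + 1))) 2).symm (stereographic' (n + 1) v y)
    with hκ
  set ψ := fun w : EuclideanSpace ℝ (Fin (n + 1)) ↦ (stereographic' (n + 1) v).symm (univBall (0 :
        EuclideanSpace ℝ (Fin (n + 1))) 2 w)
    with hψ
  have hopen : IsOpen hem := isOpen_setOf_inner_lt_zero v
  set U : TopologicalSpace.Opens M := ⟨f ⁻¹' hem, hopen.preimage hf.continuous⟩ with hU
  have hUc : (U : Set M) = f ⁻¹' hem := rfl
  have hg : ContMDiffOn I 𝓘(ℝ, EuclideanSpace ℝ (Fin (n + 1))) ∞ (κ ∘ f) U :=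
    (contMDiffOn_univBall_symm_stereographic' v).comp hf.contMDiffOn fun x hx ↦ hx
  have hdg : ∀ x ∈ U, Surjective (mfderiv I 𝓘(ℝ, EuclideanSpace ℝ (Fin (n + 1))) (κ ∘ f) x) := by
    intro x hx
    have hκd : MDifferentiableAt (𝓡 (n + 1)) 𝓘(ℝ, EuclideanSpace ℝ (Fin (n + 1))) κ (f x) :=
      ((contMDiffOn_univBall_symm_stereographic' v).contMDiffAt
        (hopen.mem_nhds hx)).mdifferentiableAt (by simp)
    have hfd : MDifferentiableAt I (𝓡 (n + 1)) f x := (hf x).mdifferentiableAt (by simp)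
    rw [mfderiv_comp x hκd hfd]
    exact (surjective_mfderiv_univBall_symm_stereographic' hx).comp (hreg x hx)
  have hK : ∀ (u : EuclideanSpace ℝ (Fin (n + 1))) (R : ℝ),
        IsCompact ((U : Set M) ∩ (κ ∘ f) ⁻¹' closedBall u R) := by
    intro u R
    have : (U : Set M) ∩ (κ ∘ f) ⁻¹' closedBall u R = f ⁻¹' (hem ∩ κ ⁻¹' closedBall u R) := by
      rw [hUc]; rfl
    rw [this, hhem, hκ, setOf_inner_lt_zero_inter_preimage v]
    exact (((isCompact_closedBall u R).image
      (contMDiff_stereographic'_symm_univBall v).continuous).isClosed.preimage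
        hf.continuous).isCompact
  have hnegv : (-v : (Metric.sphere (0 : EuclideanSpace ℝ (Fin (n + 1 + 1))) 1)) ∈ hem :=
        inner_neg_self_lt_zero v
  have hκv : κ (-v) = 0 := by
    simp only [hκ]
    rw [stereographic'_apply_neg, univBall_symm_apply_center]
  have hψ0 : ψ 0 = -v := by
    simp only [hψ]
    rw [univBall_apply_zero, stereographic'_symm_zero]
  have hσg : range σ = (U : Set M) ∩ (κ ∘ f) ⁻¹' {(0 : EuclideanSpace ℝ (Fin (n + 1)))} := by
    rw [hσf, hUc]
    ext x
    simp only [mem_preimage, mem_singleton_iff, mem_inter_iff, comp_apply]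
    constructor
    · intro hx
      rw [hx]
      exact ⟨hnegv, hκv⟩
    · rintro ⟨hx, hx0⟩
      rw [← stereographic'_symm_univBall_univBall_symm_stereographic' hx]
      change ψ (κ (f x)) = -v
      rw [hx0, hψ0]
  obtain ⟨ι, hemb, hrange, hι0, hιg⟩ :=
    Literature.Geometry.Manifold.exists_isSmoothEmbedding_prod_euclidean_range_eq_of_surjective_mfderiv
      U hg hdg hK hσ L hσg
  refine ⟨ι, hemb, hrange.trans hUc, hι0, fun p ↦ ?_⟩
  have hp : f (ι p) ∈ hem := by
    have : ι p ∈ (U : Set M) := hrange ▸ mem_range_self p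
    exact this
  rw [← stereographic'_symm_univBall_univBall_symm_stereographic' hp]
  change ψ (κ (f (ι p))) = ψ p.2
  congr 1
  have := hιg p
  rwa [zero_add] at this

end General

/-! ### The sides of a Lefschetz-free SBLF with equatorial round image -/

namespace IsSimplifiedBrokenLefschetzFibration

variable {X : Type u} [TopologicalSpace X] [T2Space X] [SecondCountableTopology X]
  [CompactSpace X] [ChartedSpace (EuclideanSpace ℝ (Fin 4)) X] [IsManifold (𝓡 4) ∞ X]
  {o : SmoothOrientation (𝓡 4) X} {f : X → (Metric.sphere (0 : EuclideanSpace ℝ (Fin 3)) 1)} {h : ℕ}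

/-- For a pole `v = ±e₂` of `S²`, the open hemisphere opposite `v` misses the equator
`{y | y₂ = 0}`. [folklore] -/
theorem apply_two_ne_zero_of_inner_lt_zero {v y : (Metric.sphere (0 : EuclideanSpace ℝ (Fin 3)) 1)}
      (hv0 : (v : EuclideanSpace ℝ (Fin 3)) 0 = 0)
    (hv1 : (v : EuclideanSpace ℝ (Fin 3)) 1 = 0) (hy : ⟪(y : EuclideanSpace ℝ (Fin 3)),
          (v : EuclideanSpace ℝ (Fin 3))⟫_ℝ < 0) : (y : EuclideanSpace ℝ (Fin 3)) 2 ≠ 0 := by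
  intro hy2
  have : ⟪(y : EuclideanSpace ℝ (Fin 3)), (v : EuclideanSpace ℝ (Fin 3))⟫_ℝ = 0 := by
    rw [EuclideanSpace.inner_eq_star_dotProduct]
    simp [dotProduct, Fin.sum_univ_three, hv0, hv1, hy2]
  linarith

omit [T2Space X] [SecondCountableTopology X] [CompactSpace X] in
/-- **Over an open hemisphere off the equator, a Lefschetz-free SBLF with equatorial round image
has only regular points.** [cite: BaykurKamada2015, §2 (arXiv p. 7)] -/
theorem surjective_mfderiv_of_inner_lt_zero (hf : IsSimplifiedBrokenLefschetzFibration o f ∅ h)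
    (hround : f '' ({p : X | ¬ Surjective (mfderiv (𝓡 4) (𝓡 2) f p)} \
      (↑(∅ : Finset X) : Set X)) = sphereEquator 1)
    {v : (Metric.sphere (0 : EuclideanSpace ℝ (Fin 3)) 1)} (hv0 : (v : EuclideanSpace ℝ (Fin 3)) 0
          = 0) (hv1 : (v : EuclideanSpace ℝ (Fin 3)) 1 = 0)
    {q : X} (hq : ⟪(f q : EuclideanSpace ℝ (Fin 3)), (v : EuclideanSpace ℝ (Fin 3))⟫_ℝ < 0) :
    Surjective (mfderiv (𝓡 4) (𝓡 2) f q) := by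
  have _ := hf
  by_contra hq'
  have hmem : f q ∈ sphereEquator 1 := by
    rw [← hround]
    exact ⟨q, ⟨hq', by simp⟩, rfl⟩
  rw [mem_sphereEquator_iff] at hmem
  exact apply_two_ne_zero_of_inner_lt_zero hv0 hv1 hq hmem

/-- **The sides of a Lefschetz-free SBLF are products `F × ℝ²` (open form of Baykur–Kamada 2015,
§2).**  Let `f : X → S²` be a simplified broken Lefschetz fibration on a closed 4-manifold with no
Lefschetz points whose round image is the equator `{y | y₂ = 0}` (the normal form of
`exists_image_round_eq_sphereEquator`), and let `v = ±e₂` be a pole (`v₀ = v₁ = 0`).  Then there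
are a closed connected surface `F` and a smooth embedding `ι : F × ℝ² ↪ X` onto the side
`f⁻¹{y | ⟪y, v⟫ < 0}` over the open hemisphere opposite `v`, such that `ι (·, 0)` is a smooth
embedding onto the central fibre `f⁻¹(-v)` and `f (ι (θ, w)) = σᵥ⁻¹ (univBall 0 2 w)` depends on
`w` alone (`σᵥ = stereographic' 2 v`): the side is the trivial `F`-bundle over the open disc.
[cite: BaykurKamada2015, §2 (arXiv p. 7)] [cite: BrockerJanichIDT1982, (8.12)] -/
theorem exists_isSmoothEmbedding_prod_range_eq_preimage_hemisphere
    (hf : IsSimplifiedBrokenLefschetzFibration o f ∅ h)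
    (hround : f '' ({p : X | ¬ Surjective (mfderiv (𝓡 4) (𝓡 2) f p)} \
      (↑(∅ : Finset X) : Set X)) = sphereEquator 1)
    (v : (Metric.sphere (0 : EuclideanSpace ℝ (Fin 3)) 1)) (hv0 : (v : EuclideanSpace ℝ (Fin 3)) 0
          = 0) (hv1 : (v : EuclideanSpace ℝ (Fin 3)) 1 = 0) :
    ∃ (F : Type u) (_ : TopologicalSpace F) (_ : T2Space F) (_ : SecondCountableTopology F)
      (_ : CompactSpace F) (_ : ConnectedSpace F) (_ : ChartedSpace (EuclideanSpace ℝ (Fin 2)) F)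
      (_ : IsManifold (𝓡 2) ∞ F) (ι : F × EuclideanSpace ℝ (Fin 2) → X),
      Manifold.IsSmoothEmbedding ((𝓡 2).prod (𝓡 2)) (𝓡 4) ∞ ι ∧
      range ι = f ⁻¹' {y | ⟪(y : EuclideanSpace ℝ (Fin 3)), (v : EuclideanSpace ℝ (Fin 3))⟫_ℝ < 0} ∧
      Manifold.IsSmoothEmbedding (𝓡 2) (𝓡 4) ∞ (fun θ ↦ ι (θ, 0)) ∧
      range (fun θ ↦ ι (θ, 0)) = f ⁻¹' {-v} ∧
      ∀ p, f (ι p) = (stereographic' 2 v).symm (univBall (0 : EuclideanSpace ℝ (Fin 2)) 2 p.2) := by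
  have hreg : ∀ q, ⟪(f q : EuclideanSpace ℝ (Fin 3)),
        (v : EuclideanSpace ℝ (Fin 3))⟫_ℝ < 0 → Surjective (mfderiv (𝓡 4) (𝓡 2) f q) :=
    fun q hq ↦ hf.surjective_mfderiv_of_inner_lt_zero hround hv0 hv1 hq
  have hregv : ∀ q, f q = -v → Surjective (mfderiv (𝓡 4) (𝓡 2) f q) := fun q hq ↦
    hreg q (by rw [hq]; exact inner_neg_self_lt_zero v)
  obtain ⟨F, _, _, _, _, _, _, _, σ, hσ, hσf⟩ := hf.exists_isSmoothEmbedding_range_eq_fibre hregv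
  have hdim : Module.finrank ℝ (EuclideanSpace ℝ (Fin 2) × EuclideanSpace ℝ (Fin 2)) =
        Module.finrank ℝ (EuclideanSpace ℝ (Fin 4)) := by
    rw [Module.finrank_prod, finrank_euclideanSpace_fin, finrank_euclideanSpace_fin]
  let L : (EuclideanSpace ℝ (Fin 2) × EuclideanSpace ℝ (Fin 2)) ≃L[ℝ] EuclideanSpace ℝ (Fin 4) :=
        ContinuousLinearEquiv.ofFinrankEq hdim
  obtain ⟨ι, hemb, hrange, hι0, hιf⟩ :=
    Literature.Topology.FourManifolds.exists_isSmoothEmbedding_prod_range_eq_preimage_hemisphere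
      (I := 𝓡 4) (IF := 𝓡 2) hf.contMDiff v hreg hσ L hσf
  have hισ : (fun θ ↦ ι (θ, 0)) = σ := funext hι0
  refine ⟨F, inferInstance, inferInstance, inferInstance, inferInstance, inferInstance,
    inferInstance, inferInstance, ι, hemb, hrange, ?_, ?_, hιf⟩
  · rw [hισ]; exact hσ
  · rw [hισ]; exact hσf

end IsSimplifiedBrokenLefschetzFibration

end Literature.Topology.FourManifolds

end
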